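import Summits.CriticalPhenomena.PercolationContinuityZ3.Theses.PercClusterResistance
import Literature.Probability.Percolation.SiteConnectionTools

/-!
# Birth skeleton (BC3) — crux `WallSumLinear` of route `PercClusterResistance`
# (`Summits/CriticalPhenomena/PercolationContinuityZ3/Cruxes/WallSumLinear/Lines/birth.lean`)

Crux (item `stmt-CriticalPhenomena-5590`, rank 2, FIXED — never restated here):
`WallSumLinear : ∃ C, ∀ k ≥ 1, Σ_{x ∈ ∂ⁱⁿΛ_k} P_{p_c}(0 ↔ x inside Λ_k) ≤ C·k` on `ℤ³`.

Line = the route's own foreseen two-layer plan ("WallSumLinear ⇐ MixedArmBound → BKWallSplit",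
route header TWO-LAYER PLAN), typed over existing declarations:

* `stub_wallSplit` (**midpoint split**, provable now, M/L): for every density `p`, every
  `k ≥ 1` and every wall site `x ∈ ∂ⁱⁿΛ_k`,
  `P_p(0 ↔ x in Λ_k) ≤ P_p(A_{⌊k/2⌋}) · P_p(H_{⌊(k-1)/2⌋})`, where `A_n = siteToBoundary 3 n` is the
  bulk one-arm event `{0 ↔ ∂Λ_n in Λ_n}` and `H_r` is the half-space one-arm event of
  `PercLowPointHalfSpace.QuantitativeBGN` (`0` joined inside `ℍ = {z | 0 ≤ z 0}` to sup-distance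
  `≥ r`). Proof on paper: an open path `0 → x` inside `Λ_k` contains an initial piece inside
  `Λ_{⌊k/2⌋}` reaching `∂ⁱⁿΛ_{⌊k/2⌋}` and a final piece inside `B(x,⌊(k-1)/2⌋) ∩ Λ_k` reaching
  sup-distance `⌊(k-1)/2⌋` from `x`; the two boxes are vertex-disjoint because
  `⌊k/2⌋ + ⌊(k-1)/2⌋ = k - 1 < k = ‖x‖_∞`, so the two events are measurable w.r.t. disjoint edge
  sets and independent under the product measure `setBer(E(ℤ³), p)` (no BK needed); finally
  `B(x,r) ∩ Λ_k` lies in the half-space through the face of `x`, and a lattice automorphism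
  (translation by `-x`, a sign flip and a coordinate swap, all preserving `P_p` and sup-distances)
  carries it into `ℍ` with `x ↦ 0`, so the second factor is `≤ P_p(H_r)` by monotonicity of
  `openConnIn` in the domain.
* `stub_mixedArmBound` (**the mixed arm bound**, XL — the load-bearing stub): at `p = p_c(ℤ³)`,
  `P(A_{⌊k/2⌋}) · P(H_{⌊(k-1)/2⌋}) ≤ C / k` for all `k ≥ 1`. Predicted truth
  `k^{-(x_h + x_s)} ≈ k^{-1.45}` (bulk one-arm exponent `x_h = β/ν ≈ 0.477`, ordinary-surface
  one-arm exponent `x_s ≈ 0.975`, DengBlote2005), margin `≈ 0.45`; boundary-only information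
  (BGN, non-quantitative) gives `o(1)` for the second factor and nothing for the first — the
  "sliver of bulk thinness" of the route header enters exactly here.
* glue (PROVED below): `|∂ⁱⁿΛ_k| ≤ 2·3·(2k+1)² ≤ 54 k²`
  (`Literature.Probability.Percolation.card_innerBoundary_box_le`), so the wall sum is
  `≤ 54k² · C/k = 54C · k`.

Disproof used: none relevant (no `Disproof.lean` / Negative lemma exists for this crux,
`ledger crux ls stmt-CriticalPhenomena-5590`: no workfiles, 2026-08-17).
-/

namespace Summit.CriticalPhenomena.PercolationContinuityZ3.Cruxes.WallSumLinear.Birth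

open Literature.Probability.LatticeModels Literature.Probability.Percolation MeasureTheory
open scoped BigOperators

/-! ### Stub signatures (named `Prop`s over existing declarations; the composition takes them BY NAME) -/

/-- Signature of `stub_wallSplit` (**midpoint split**): for every `p`, `k ≥ 1` and wall site
`x ∈ ∂ⁱⁿΛ_k`, `P_p(0 ↔ x in Λ_k) ≤ P_p(0 ↔ ∂Λ_{⌊k/2⌋} in Λ_{⌊k/2⌋}) · P_p(0 ↔_ℍ sup-distance ⌊(k-1)/2⌋)`
— bulk one-arm event `siteToBoundary 3 ⌊k/2⌋` times the half-space one-arm event of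
`PercLowPointHalfSpace.QuantitativeBGN` at radius `⌊(k-1)/2⌋` (`ℍ = {z | 0 ≤ z 0}`). -/
def Sig.stub_wallSplit : Prop :=
  ∀ (p : unitInterval) (k : ℕ), 1 ≤ k →
      ∀ x ∈ Literature.Probability.LatticeModels.innerBoundary
          (Literature.Probability.LatticeModels.zdGraph 3) (Literature.Probability.LatticeModels.box 3 k),
        (Literature.Probability.Percolation.bondPercolation
              (Literature.Probability.LatticeModels.zdGraph 3) p).real
            (Literature.Probability.Percolation.openConnIn
              ↑(Literature.Probability.LatticeModels.box 3 k) 0 x) ≤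
          (Literature.Probability.Percolation.bondPercolation
                (Literature.Probability.LatticeModels.zdGraph 3) p).real
              (Literature.Probability.Percolation.siteToBoundary 3 (k / 2)) *
            (Literature.Probability.Percolation.bondPercolation
                (Literature.Probability.LatticeModels.zdGraph 3) p).real
              {ω | ∃ y : Literature.Probability.LatticeModels.Site 3,
                (∃ i : Fin 3, (((k - 1) / 2 : ℕ) : ℤ) ≤ |y i|) ∧
                  ω ∈ Literature.Probability.Percolation.openConnIn
                    {z : Literature.Probability.LatticeModels.Site 3 | 0 ≤ z 0} 0 y}

/-- Signature of `stub_mixedArmBound` (**mixed arm bound at `p_c(ℤ³)`**, load-bearing, XL): the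
bulk one-arm probability to distance `⌊k/2⌋` times the half-space one-arm probability to distance
`⌊(k-1)/2⌋` is `≤ C/k` for all `k ≥ 1`. Predicted `≍ k^{-(x_h+x_s)} ≈ k^{-1.45}` (DengBlote2005;
route header NUMBERS), margin `≈ 0.45`. -/
def Sig.stub_mixedArmBound : Prop :=
  ∃ C : ℝ, ∀ k : ℕ, 1 ≤ k →
      (Literature.Probability.Percolation.bondPercolation
            (Literature.Probability.LatticeModels.zdGraph 3)
            (Literature.Probability.Percolation.criticalProbI 3)).real
          (Literature.Probability.Percolation.siteToBoundary 3 (k / 2)) *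
        (Literature.Probability.Percolation.bondPercolation
            (Literature.Probability.LatticeModels.zdGraph 3)
            (Literature.Probability.Percolation.criticalProbI 3)).real
          {ω | ∃ y : Literature.Probability.LatticeModels.Site 3,
            (∃ i : Fin 3, (((k - 1) / 2 : ℕ) : ℤ) ≤ |y i|) ∧
              ω ∈ Literature.Probability.Percolation.openConnIn
                {z : Literature.Probability.LatticeModels.Site 3 | 0 ≤ z 0} 0 y} ≤ C / k

/-! ### The stubs -/

/-- **Stub 1 — midpoint split** (provable now, M/L: independence of the vertex-disjoint boxes
`Λ_{⌊k/2⌋}` and `B(x,⌊(k-1)/2⌋)` under the product measure, path surgery at first exits, the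
lattice automorphism carrying `Λ_k ∩ B(x,r)` into `ℍ` with `x ↦ 0`, monotonicity of `openConnIn`
in the domain; BK is not needed). -/
theorem stub_wallSplit : Sig.stub_wallSplit := by
  sorry

/-- **Stub 2 — mixed arm bound at `p_c(ℤ³)`** (the load-bearing, XL stub: an UPPER bound on
critical arm probabilities in `d = 3`; boundary-only input (BGN) bounds the half-space factor by
`o(1)` only, so the bulk factor must contribute — the route header's "sliver of bulk thinness"). -/
theorem stub_mixedArmBound : Sig.stub_mixedArmBound := by
  sorry

/-! ### Glue (proved) and the composition (kernel-checked, no sorry) -/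

/-- Glue (proved): the wall of `Λ_k ⊆ ℤ³` has at most `54 k²` sites for `k ≥ 1`
(`|∂ⁱⁿΛ_k| ≤ 6(2k+1)²`, `Literature.Probability.Percolation.card_innerBoundary_box_le`). -/
theorem card_wall_le (k : ℕ) (hk : 1 ≤ k) :
    ((innerBoundary (zdGraph 3) (box 3 k)).card : ℝ) ≤ 54 * (k : ℝ) ^ 2 := by
  have h := card_innerBoundary_box_le (d := 3) k
  have h1 : ((innerBoundary (zdGraph 3) (box 3 k)).card : ℝ) ≤
      ((2 * 3 * (2 * k + 1) ^ (3 - 1) : ℕ) : ℝ) := by exact_mod_cast h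
  have h2 : ((2 * 3 * (2 * k + 1) ^ (3 - 1) : ℕ) : ℝ) = 6 * (2 * (k : ℝ) + 1) ^ 2 := by
    push_cast; ring
  have hk' : (1 : ℝ) ≤ k := by exact_mod_cast hk
  rw [h2] at h1
  nlinarith [h1, hk']

/-- **Composition:** the two stubs (taken BY NAME) imply the crux `WallSumLinear` BY NAME, with
constant `54·C`: the pointwise bound `C/k` (split, then mixed arm bound) summed over the `≤ 54k²`
wall sites. -/
theorem WallSumLinear_of :
    Sig.stub_wallSplit → Sig.stub_mixedArmBound →
      Summit.CriticalPhenomena.PercolationContinuityZ3.Theses.PercClusterResistance.WallSumLinear := by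
  intro hsplit hmixed
  dsimp only [Sig.stub_wallSplit] at hsplit
  dsimp only [Sig.stub_mixedArmBound] at hmixed
  obtain ⟨C, hC⟩ := hmixed
  refine ⟨54 * C, fun k hk => ?_⟩
  -- pointwise bound on the wall: split, then the mixed arm bound
  have hpt : ∀ x ∈ innerBoundary (zdGraph 3) (box 3 k),
      (bondPercolation (zdGraph 3) (criticalProbI 3)).real (openConnIn ↑(box 3 k) 0 x) ≤ C / k :=
    fun x hx => (hsplit (criticalProbI 3) k hk x hx).trans (hC k hk)
  -- `0 ≤ C` from the case `k = 1` (a product of probabilities is nonnegative)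
  have hC0 : 0 ≤ C := by
    have h := hC 1 le_rfl
    simp only [Nat.cast_one, div_one] at h
    exact le_trans (mul_nonneg measureReal_nonneg measureReal_nonneg) h
  have hk0 : (k : ℝ) ≠ 0 := by
    have : (1 : ℝ) ≤ k := by exact_mod_cast hk
    positivity
  have hdiv : 0 ≤ C / k := div_nonneg hC0 (Nat.cast_nonneg k)
  calc ∑ x ∈ innerBoundary (zdGraph 3) (box 3 k),
        (bondPercolation (zdGraph 3) (criticalProbI 3)).real (openConnIn ↑(box 3 k) 0 x)
      ≤ ∑ _x ∈ innerBoundary (zdGraph 3) (box 3 k), C / k := Finset.sum_le_sum hpt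
    _ = ((innerBoundary (zdGraph 3) (box 3 k)).card : ℝ) * (C / k) := by
        rw [Finset.sum_const, nsmul_eq_mul]
    _ ≤ 54 * (k : ℝ) ^ 2 * (C / k) := mul_le_mul_of_nonneg_right (card_wall_le k hk) hdiv
    _ = 54 * C * k := by field_simp

end Summit.CriticalPhenomena.PercolationContinuityZ3.Cruxes.WallSumLinear.Birth
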